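import Summits.Ventures.WeilGRH.DualTrigKernelLatticeDefs
import HarnessLib

/-!
# Format D-K v3 (multi-lattice): soundness, part B — real objects, representations, periodicity of the
lattice parts, and the split of the incommensurable window terms over the lattices

Cell `rh-explicit`, WEIL TRACK — GRH ARM, route B (weil-grh-3).  For a v3 certificate `c : DKCert3`:
the real terms (`terms3R`, `latTermsR`, `restR`, `allAtomsT`, the full function `P3`); the computed terms
enclose them (`terms3_repr`, `latTerms_repr`, `restTerms_repr`); each lattice part `T_p` is
`2π/r_p`-periodic in `θ` (`latT_periodic`) and even in the even case; and the incommensurable window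
values, bucketed by the distinct lattice primes plus the rest, are a permutation of themselves
(`perm_bucketOf`), whence `sumVal_ncVals_split`.  Everything here is PROVED; no named facts, no `sorry`,
no kernel evaluation.
-/

noncomputable section

open Finset Real Complex

namespace Summit.Ventures.WeilGRH

open Literature.Analysis.ValidatedNumerics.NumericsMP
open Literature.NumberTheory.LFunctions
open DualTrigTaylor DigammaVertical

namespace DKCert

variable {c : DKCert}

/-- A sub-list of the window data is enclosed termwise by its computed terms. [folklore] -/
theorem vals_repr (hS : 0 < c.S) (hpi : MI.mem c.S Real.pi c.piI) (hlog : MI.mem c.S (Real.log c.p0) c.logp0I)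
    (hp0 : 2 ≤ c.p0) (hvals : c.valsOK = true) :
    ∀ (vs : List DKVal), (∀ v ∈ vs, v ∈ c.vals) → ∀ {ts : List GTerm},
      (vs.map c.valTerm).mapM id = some ts → List.Forall₂ (GRepr c.S c.R) ts (vs.map c.valR) := by
  intro vs
  induction vs with
  | nil => intro _ ts h; simp at h; subst h; exact List.Forall₂.nil
  | cons v vs ih =>
      intro hmem ts h
      rw [List.map_cons, List.mapM_cons] at h
      cases hv : c.valTerm v with
      | none => simp [hv] at h
      | some t =>
        simp only [hv, id, Option.pure_def, Option.bind_eq_bind, Option.bind_some] at h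
        cases hrest : (vs.map c.valTerm).mapM id with
        | none => simp [hrest] at h
        | some ts' =>
          simp only [hrest, Option.bind_some, Option.some.injEq] at h
          subst h
          obtain ⟨hp, he, hpe, _, _, hvv, hsd, hslo, hshi⟩ := valsOK_val hvals (hmem v (by simp))
          have hn : 1 ≤ v.n := by rw [← hpe]; exact Nat.one_le_pow _ _ hp.pos
          exact List.Forall₂.cons (valTerm_repr hS hpi hlog hp0 v hvv hsd hn hslo hshi hv)
            (ih (fun w hw ↦ hmem w (by simp [hw])) hrest)

end DKCert

namespace DKCert3

variable {c : DKCert3}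

/-! ### Real objects of a v3 certificate -/

/-- The real ratio `r_p = D₀ log p / (D log p₀)`. [folklore] -/
def ratR (c : DKCert3) (l : DKLat) : ℝ := (c.base.D * Real.log l.p) / (l.D * Real.log c.base.p0)

/-- The frequency unit `ω_p = log p / D` of a lattice. [folklore] -/
def omegaL (l : DKLat) : ℝ := Real.log l.p / l.D

/-- The real term (in `θ`) of a lattice atom: frequency `k r_p`. [folklore] -/
def latAtomR (c : DKCert3) (l : DKLat) (atm : DKAtom) : RTerm :=
  ⟨atm.k * c.ratR l, (atm.a : ℝ) / 2 ^ c.base.cden, (atm.b : ℝ) / 2 ^ c.base.cden⟩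

/-- The lattice atom as a `TrigAtom` in `τ`: frequency `k ω_p`. [folklore] -/
def latAtomT (c : DKCert3) (l : DKLat) (atm : DKAtom) : TrigAtom :=
  ⟨atm.k * omegaL l, (atm.a : ℝ) / 2 ^ c.base.cden, (atm.b : ℝ) / 2 ^ c.base.cden⟩

/-- The real atom terms of a lattice. [folklore] -/
def latAtomsR (c : DKCert3) (l : DKLat) : List RTerm := l.atoms.map (c.latAtomR l)

/-- The real atom terms of a list of lattices. [folklore] -/
def latJoinR (c : DKCert3) : List DKLat → List RTerm
  | [] => []
  | l :: ls => c.latAtomsR l ++ c.latJoinR ls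

/-- The lattice atoms of a list of lattices as `TrigAtom`s. [folklore] -/
def latJoinT (c : DKCert3) : List DKLat → List TrigAtom
  | [] => []
  | l :: ls => l.atoms.map (c.latAtomT l) ++ c.latJoinT ls

/-- All real terms of the full inequality. [folklore] -/
def terms3R (c : DKCert3) : List RTerm := c.base.termsR ++ c.latJoinR c.lats

/-- The real window terms of a lattice. [folklore] -/
def latWinR (c : DKCert3) (l : DKLat) : List RTerm := (c.latVals l).map c.base.valR

/-- The real terms of `T_p`. [folklore] -/
def latTermsR (c : DKCert3) (l : DKLat) : List RTerm := c.latWinR l ++ c.latAtomsR l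

/-- The real window terms on no lattice. [folklore] -/
def restR (c : DKCert3) : List RTerm := c.restVals.map c.base.valR

/-- All atoms (base and lattices) as `TrigAtom`s in `τ`. [folklore] -/
def allAtomsT (c : DKCert3) : List TrigAtom := c.base.atoms.map c.base.atomT ++ c.latJoinT c.lats

/-- The full function in `θ = ωτ`: `Re ψ(σ' + iρθ) + (log q − log π) + Σ_t val_t(θ)`. [folklore] -/
def P3 (c : DKCert3) (θ : ℝ) : ℝ :=
  (Complex.digamma ((c.base.sigR : ℂ) + (c.base.rhoR * θ : ℝ) * I)).re + c.base.constR + sumVal c.terms3R θ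

/-- `P3 = Pθ(base) + lattice atoms`. [folklore] -/
theorem P3_eq (θ : ℝ) : c.P3 θ = c.base.Pθ θ + sumVal (c.latJoinR c.lats) θ := by
  unfold P3 DKCert.Pθ terms3R; rw [DKCert.sumVal_append]; ring

/-! ### Representations -/

/-- `latAtomTerm` encloses `latAtomR`. [folklore] -/
theorem latAtomTerm_repr (hS : 0 < c.base.S) {l : DKLat} (hr : MI.mem c.base.S (c.ratR l) l.rI) (atm : DKAtom) :
    DKCert.GRepr c.base.S c.base.R (c.latAtomTerm l atm) (c.latAtomR l atm) := by
  have hk : MI.mem c.base.S ((atm.k : ℝ) * c.ratR l) (l.rI.mulInt atm.k) := by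
    have := MI.mem_mulInt hr (atm.k : ℤ); push_cast at this; rw [mul_comm]; exact this
  have hp := (DKCert.powList_spec hS hk (2 * c.base.R + 1)).2
  refine ⟨?_, ?_, hk, hp, fun h ↦ by simp [latAtomTerm] at h, fun h ↦ by simp [latAtomTerm] at h⟩
  · have := MI.mem_ofFrac c.base.S atm.a (q := 2 ^ c.base.cden) (by positivity)
    simp only [latAtomTerm, latAtomR]; push_cast at this ⊢; exact this
  · have := MI.mem_ofFrac c.base.S atm.b (q := 2 ^ c.base.cden) (by positivity)
    simp only [latAtomTerm, latAtomR]; push_cast at this ⊢; exact this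

/-- `latAtomTerms` encloses `latAtomsR`. [folklore] -/
theorem latAtomTerms_repr (hS : 0 < c.base.S) {l : DKLat} (hr : MI.mem c.base.S (c.ratR l) l.rI) :
    List.Forall₂ (DKCert.GRepr c.base.S c.base.R) (c.latAtomTerms l) (c.latAtomsR l) := by
  unfold latAtomTerms latAtomsR
  rw [List.forall₂_map_left_iff, List.forall₂_map_right_iff]
  exact List.forall₂_same.2 fun atm _ ↦ latAtomTerm_repr hS hr atm

/-- `latJoin` encloses `latJoinR`. [folklore] -/
theorem latJoin_repr (hS : 0 < c.base.S) : ∀ (ls : List DKLat), (∀ l ∈ ls, MI.mem c.base.S (c.ratR l) l.rI) →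
    List.Forall₂ (DKCert.GRepr c.base.S c.base.R) (c.latJoin ls) (c.latJoinR ls)
  | [], _ => by simp [latJoin, latJoinR]
  | l :: ls, h => by
      simp only [latJoin, latJoinR]
      exact List.rel_append (latAtomTerms_repr hS (h l (by simp))) (latJoin_repr hS ls fun l' hl' ↦ h l' (by simp [hl']))

/-- The lattice atoms are non-periodic terms (of the base lattice). [folklore] -/
theorem latJoin_comm : ∀ (ls : List DKLat), ∀ t ∈ c.latJoin ls, t.comm = false
  | [] => by simp [latJoin]
  | l :: ls => by
      intro t ht
      simp only [latJoin, List.mem_append] at ht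
      rcases ht with ht | ht
      · unfold latAtomTerms at ht; rw [List.mem_map] at ht
        obtain ⟨atm, _, rfl⟩ := ht; rfl
      · exact latJoin_comm ls t ht

/-- **`terms3` encloses `terms3R`.** [folklore] -/
theorem terms3_repr (hS : 0 < c.base.S) (hpi : MI.mem c.base.S Real.pi c.base.piI)
    (hlog : MI.mem c.base.S (Real.log c.base.p0) c.base.logp0I) (hp0 : 2 ≤ c.base.p0) (hvals : c.base.valsOK = true)
    (hr : ∀ l ∈ c.lats, MI.mem c.base.S (c.ratR l) l.rI) :
    List.Forall₂ (DKCert.GRepr c.base.S c.base.R) c.terms3 c.terms3R :=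
  List.rel_append (DKCert.terms_repr hS hpi hlog hp0 hvals) (latJoin_repr hS c.lats hr)

/-- The lattice window values are window values. [folklore] -/
theorem mem_vals_of_mem_latVals {l : DKLat} {v : DKVal} (h : v ∈ c.latVals l) : v ∈ c.base.vals := by
  unfold latVals ncVals at h
  exact List.mem_of_mem_filter (List.mem_of_mem_filter h)

/-- The rest window values are window values. [folklore] -/
theorem mem_vals_of_mem_restVals {v : DKVal} (h : v ∈ c.restVals) : v ∈ c.base.vals := by
  unfold restVals ncVals at h
  exact List.mem_of_mem_filter (List.mem_of_mem_filter h)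

/-- **`latTerms` encloses `latTermsR`.** [folklore] -/
theorem latTerms_repr (hS : 0 < c.base.S) (hpi : MI.mem c.base.S Real.pi c.base.piI)
    (hlog : MI.mem c.base.S (Real.log c.base.p0) c.base.logp0I) (hp0 : 2 ≤ c.base.p0) (hvals : c.base.valsOK = true)
    {l : DKLat} (hr : MI.mem c.base.S (c.ratR l) l.rI) {ws : List DKCert.GTerm} (hws : c.latWinTerms l = some ws) :
    List.Forall₂ (DKCert.GRepr c.base.S c.base.R) (c.latTerms l) (c.latTermsR l) := by
  unfold latTerms latTermsR latWinR
  rw [hws, Option.getD_some]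
  refine List.rel_append ?_ (latAtomTerms_repr hS hr)
  unfold latWinTerms at hws
  exact DKCert.vals_repr hS hpi hlog hp0 hvals (c.latVals l) (fun v hv ↦ mem_vals_of_mem_latVals hv) hws

/-- `restTerms` encloses `restR`. [folklore] -/
theorem restTerms_repr (hS : 0 < c.base.S) (hpi : MI.mem c.base.S Real.pi c.base.piI)
    (hlog : MI.mem c.base.S (Real.log c.base.p0) c.base.logp0I) (hp0 : 2 ≤ c.base.p0) (hvals : c.base.valsOK = true)
    {ws : List DKCert.GTerm} (hws : c.restTerms = some ws) :
    List.Forall₂ (DKCert.GRepr c.base.S c.base.R) ws c.restR := by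
  unfold restTerms at hws
  exact DKCert.vals_repr hS hpi hlog hp0 hvals c.restVals (fun v hv ↦ mem_vals_of_mem_restVals hv) hws

/-! ### Periodicity and symmetry of the lattice parts -/

/-- `r_p > 0` and `r_p ω = ω_p`. [folklore] -/
theorem ratR_pos_and_mul (hp0 : 2 ≤ c.base.p0) (hD : 1 ≤ c.base.D) {l : DKLat} (hp : 2 ≤ l.p) (hDl : 1 ≤ l.D) :
    0 < c.ratR l ∧ c.ratR l * c.base.omegaR = omegaL l := by
  have hl0 : 0 < Real.log c.base.p0 := Real.log_pos (by exact_mod_cast hp0)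
  have hlp : 0 < Real.log l.p := Real.log_pos (by exact_mod_cast hp)
  have hDr : (0 : ℝ) < c.base.D := by exact_mod_cast hD
  have hDlr : (0 : ℝ) < l.D := by exact_mod_cast hDl
  refine ⟨by unfold ratR; positivity, ?_⟩
  unfold ratR DKCert.omegaR omegaL
  field_simp

/-- A sum of terms with frequencies in `r ℤ` is invariant under `θ ↦ θ + m · 2π/r`. [folklore] -/
theorem sumVal_add_mul_period (ts : List RTerm) {r : ℝ} (hr : r ≠ 0) (hl : ∀ t ∈ ts, ∃ k : ℤ, t.κ = k * r)
    (θ : ℝ) (m : ℤ) : sumVal ts (θ + m * (2 * π / r)) = sumVal ts θ := by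
  induction ts with
  | nil => simp
  | cons t l ih =>
      obtain ⟨k, hk⟩ := hl t (by simp)
      rw [sumVal_cons, sumVal_cons, ih (fun s hs ↦ hl s (by simp [hs]))]
      congr 1
      simp only [RTerm.val, hk, mul_add]
      have e : (k : ℝ) * r * (m * (2 * π / r)) = ((k * m : ℤ) : ℝ) * (2 * π) := by
        push_cast; field_simp
      rw [e, Real.cos_add_int_mul_two_pi, Real.sin_add_int_mul_two_pi]

/-- Every real term of `T_p` has frequency in `r_p ℤ`. [folklore] -/
theorem latTermsR_freq (hp0 : 2 ≤ c.base.p0) (hvals : c.base.valsOK = true)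
    {l : DKLat} (hDl : 1 ≤ l.D) : ∀ t ∈ c.latTermsR l, ∃ k : ℤ, t.κ = k * c.ratR l := by
  intro t ht
  unfold latTermsR at ht
  rw [List.mem_append] at ht
  rcases ht with ht | ht
  · unfold latWinR at ht; rw [List.mem_map] at ht
    obtain ⟨v, hv, rfl⟩ := ht
    have hvp : v.p = l.p := by
      unfold latVals at hv; have := (List.mem_filter.1 hv).2; simpa using this
    obtain ⟨_, _, hpe, -⟩ := DKCert.valsOK_val hvals (mem_vals_of_mem_latVals hv)
    refine ⟨(v.e * l.D : ℕ), ?_⟩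
    simp only [DKCert.valR, ratR]
    have hl0 : 0 < Real.log c.base.p0 := Real.log_pos (by exact_mod_cast hp0)
    have hDlr : (0 : ℝ) < l.D := by exact_mod_cast hDl
    rw [← hpe, hvp]; push_cast
    rw [Real.log_pow]; field_simp
  · unfold latAtomsR at ht; rw [List.mem_map] at ht
    obtain ⟨atm, _, rfl⟩ := ht
    exact ⟨atm.k, by simp [latAtomR]⟩

/-- `T_p` is `2π/r_p`-periodic. [folklore] -/
theorem latT_periodic (hp0 : 2 ≤ c.base.p0) (hD : 1 ≤ c.base.D) (hvals : c.base.valsOK = true)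
    {l : DKLat} (hp : 2 ≤ l.p) (hDl : 1 ≤ l.D) (θ : ℝ) (m : ℤ) :
    sumVal (c.latTermsR l) (θ + m * (2 * π / c.ratR l)) = sumVal (c.latTermsR l) θ :=
  sumVal_add_mul_period _ (ratR_pos_and_mul hp0 hD hp hDl).1.ne' (latTermsR_freq hp0 hvals hDl) θ m

/-- In the even case every real term of `T_p` has vanishing sine coefficient. [folklore] -/
theorem latTermsR_B_zero (hvals : c.base.valsOK = true) (heven : c.base.even = true) {l : DKLat}
    (hb : ∀ atm ∈ l.atoms, atm.b = 0) : ∀ t ∈ c.latTermsR l, t.B = 0 := by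
  intro t ht
  unfold latTermsR at ht
  rw [List.mem_append] at ht
  rcases ht with ht | ht
  · unfold latWinR at ht; rw [List.mem_map] at ht
    obtain ⟨v, hv, rfl⟩ := ht
    refine DKCert.termsR_B_zero hvals heven _ ?_
    unfold DKCert.termsR
    exact List.mem_append_right _ (List.mem_map.2 ⟨v, mem_vals_of_mem_latVals hv, rfl⟩)
  · unfold latAtomsR at ht; rw [List.mem_map] at ht
    obtain ⟨atm, hatm, rfl⟩ := ht
    simp [latAtomR, hb atm hatm]

/-- In the even case every lattice atom has vanishing sine coefficient (real terms). [folklore] -/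
theorem latJoinR_B_zero : ∀ (ls : List DKLat), (∀ l ∈ ls, ∀ atm ∈ l.atoms, atm.b = 0) →
    ∀ t ∈ c.latJoinR ls, t.B = 0
  | [], _ => by simp [latJoinR]
  | l :: ls, h => by
      intro t ht
      simp only [latJoinR, List.mem_append] at ht
      rcases ht with ht | ht
      · unfold latAtomsR at ht; rw [List.mem_map] at ht
        obtain ⟨atm, hatm, rfl⟩ := ht
        simp [latAtomR, h l (by simp) atm hatm]
      · exact latJoinR_B_zero ls (fun l' hl' ↦ h l' (by simp [hl'])) t ht

/-! ### Splitting the incommensurable window terms over the lattices -/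

/-- Bucketing a list of window values by a list of primes: for each prime the values of that prime, in
order. [folklore] -/
def bucketOf : List ℕ → List DKVal → List DKVal
  | [], _ => []
  | p :: ps, xs => (xs.filter fun v => v.p == p) ++ bucketOf ps xs

/-- Values of other primes survive the removal of one prime. [folklore] -/
theorem bucketOf_filter_ne : ∀ (ps : List ℕ) (p : ℕ), p ∉ ps → ∀ (xs : List DKVal),
    bucketOf ps (xs.filter fun v => !(v.p == p)) = bucketOf ps xs
  | [], _, _, _ => by simp [bucketOf]
  | p' :: ps, p, hp, xs => by
      have hne : p' ≠ p := fun e ↦ hp (by simp [e])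
      have hp' : p ∉ ps := fun h ↦ hp (List.mem_cons_of_mem _ h)
      simp only [bucketOf]
      rw [bucketOf_filter_ne ps p hp' xs, List.filter_filter]
      congr 1
      apply List.filter_congr
      intro v _
      by_cases hv : v.p = p'
      · simp [hv, hne]
      · simp [hv]

/-- Bucketing by distinct primes, then the rest, is a permutation. [folklore] -/
theorem perm_bucketOf : ∀ (ps : List ℕ), ps.Nodup → ∀ (xs : List DKVal),
    List.Perm (bucketOf ps xs ++ xs.filter fun v => !(ps.elem v.p)) xs
  | [], _, xs => by
      simp only [bucketOf, List.nil_append]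
      have : (xs.filter fun v => !(([] : List ℕ).elem v.p)) = xs := by
        rw [List.filter_eq_self]; intro v _; simp
      rw [this]
  | p :: ps, hnd, xs => by
      rw [List.nodup_cons] at hnd
      obtain ⟨hp, hnd'⟩ := hnd
      have h1 := List.filter_append_perm (fun v : DKVal => v.p == p) xs
      set ys := xs.filter (fun v : DKVal => !(v.p == p)) with hys
      have ih := perm_bucketOf ps hnd' ys
      rw [hys, bucketOf_filter_ne ps p hp xs] at ih
      have hrest : ((xs.filter fun v : DKVal => !(v.p == p)).filter fun v => !(ps.elem v.p)) =
          xs.filter fun v => !((p :: ps).elem v.p) := by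
        rw [List.filter_filter]
        apply List.filter_congr
        intro v _
        by_cases hv : v.p = p
        · simp [hv]
        · simp [hv]
      rw [hrest] at ih
      simp only [bucketOf, List.append_assoc]
      exact (List.Perm.append_left _ ih).trans h1

/-- `bucketOf` over the lattice primes of the incommensurable values is the concatenation of the
lattices' window values. [folklore] -/
theorem sumVal_bucketOf (θ : ℝ) : ∀ (ls : List DKLat),
    sumVal ((bucketOf (ls.map (·.p)) c.ncVals).map c.base.valR) θ = (ls.map fun l ↦ sumVal (c.latWinR l) θ).sum
  | [] => by simp [bucketOf]
  | l :: ls => by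
      rw [List.map_cons, List.map_cons, List.sum_cons, ← sumVal_bucketOf θ ls]
      simp only [bucketOf, List.map_append, DKCert.sumVal_append]
      rfl

/-- The lattice atoms sum lattice by lattice. [folklore] -/
theorem sumVal_latJoinR (θ : ℝ) : ∀ (ls : List DKLat),
    sumVal (c.latJoinR ls) θ = (ls.map fun l ↦ sumVal (c.latAtomsR l) θ).sum
  | [] => by simp [latJoinR]
  | l :: ls => by
      rw [List.map_cons, List.sum_cons, ← sumVal_latJoinR θ ls]
      simp only [latJoinR, DKCert.sumVal_append]

/-- **The split of the incommensurable window terms plus the lattice atoms** into the lattice parts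
`T_p` and the rest. [folklore] -/
theorem sumVal_ncVals_split (hnd : (c.lats.map (·.p)).Nodup) (θ : ℝ) :
    sumVal (c.ncVals.map c.base.valR) θ + sumVal (c.latJoinR c.lats) θ =
      (c.lats.map fun l ↦ sumVal (c.latTermsR l) θ).sum + sumVal c.restR θ := by
  have hperm := (perm_bucketOf (c.lats.map (·.p)) hnd c.ncVals).map (fun v ↦ (c.base.valR v).val θ)
  have hsum := hperm.sum_eq
  rw [List.map_append, List.sum_append] at hsum
  have e1 : sumVal (c.ncVals.map c.base.valR) θ = (c.ncVals.map fun v ↦ (c.base.valR v).val θ).sum := by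
    simp [sumVal, List.map_map, Function.comp_def]
  have e2 : sumVal ((bucketOf (c.lats.map (·.p)) c.ncVals).map c.base.valR) θ =
      ((bucketOf (c.lats.map (·.p)) c.ncVals).map fun v ↦ (c.base.valR v).val θ).sum := by
    simp [sumVal, List.map_map, Function.comp_def]
  have e3 : sumVal c.restR θ = ((c.ncVals.filter fun v => !((c.lats.map (·.p)).elem v.p)).map
      fun v ↦ (c.base.valR v).val θ).sum := by
    simp [restR, restVals, sumVal, List.map_map, Function.comp_def]
  rw [e1, ← hsum, ← e2, ← e3, sumVal_bucketOf, sumVal_latJoinR]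
  have e4 : (c.lats.map fun l ↦ sumVal (c.latTermsR l) θ).sum =
      (c.lats.map fun l ↦ sumVal (c.latWinR l) θ).sum + (c.lats.map fun l ↦ sumVal (c.latAtomsR l) θ).sum := by
    rw [← List.sum_map_add]
    congr 1
    apply List.map_congr_left
    intro l _
    unfold latTermsR; rw [DKCert.sumVal_append]
  rw [e4]; ring

end DKCert3

end Summit.Ventures.WeilGRH

end
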